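import Summits.QuantumFields.GaugeBoot.PeriodicWordReversal
import Summits.QuantumFields.GaugeBoot.TiltedBoxAntiDiagonalRPGeneral
import HarnessLib

/-!
# Word holonomies under the anti-diagonal mirror of the tilted box: identifications and Wilson-loop blocks (gauge-boot, L3 supplement; tribunal A31, part 2/2)

HONEST FRAMING (cell `pub-gaugeboot`, page 1 of every file): the venture produces certified bounds
on lattice expectations at stated coupling, gauge group, dimension and torus size; NOT a mass gap,
NOT a continuum limit, NOT a string tension; NOT Yang–Mills-summit-bearing (barriers
`FixedCouplingUltralocality`, `PerturbativeInvisibility`).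

`TiltedBoxAntiDiagonalRPGeneral.lean` proves anti-diagonal reflection positivity on EVERY 45°-tilted
box `Γ(M_u, M_v, L)` (`M_u ≥ 2`) for bounded measurable half observables, with the reflection of
configurations `Θ = configAntiSwap = revConfig e' j ∘ configSwap i j ψ ∘ revConfig e j`. Tribunal t1
v2.8/2.9 A31: to use it as a BLOCK of a certificate row on a non-square box one needs `Θ` on words.
With part 1 (`PeriodicWordReversal.lean`: `revConfig` on words) and `PeriodicWordReflection.lean`
(`configSwap` on words) this file assembles:

* `isAxisSwap_antiDiag` — the anti-diagonal mirror `ψ = tiltedAntiMirror` is an axis swap of the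
  reversed presentation `(A, e')`, on every box (no size condition);
* **`wordHolonomy_configAntiSwap`**: `hol_x(w)(Θ U) = hol_{ψx}(w^{anti})(U)`, `anti = Step.antiSwap i j`
  letterwise (`+e_i ↦ -e_j`, `+e_j ↦ -e_i`, …); `map_move_antiSwap`, `Word.endpoint_antiSwap` (closed
  words go to closed words);
* **`tiltedBox_integral_comp_configAntiSwap(_complex)`** — `μ_β` of every tilted box is `Θ`-invariant
  (every real `β`), and the identifications `tiltedBox_integral_trace_wordHolonomy_antiSwap` (+ pair
  form): `E[tr ρ(hol_{ψx}(w^{anti}))] = E[tr ρ(hol_x(w))]`;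
* the ROW BLOCKS: **`tiltedBox_rAntiDiagBlock_nonneg_general`** (bounded measurable half observables,
  `β ≥ 0`, `M_u ≥ 2`, any `M_v, L`) and **`tiltedBox_rAntiDiagWilsonBlock_nonneg`**: for words `w_a`
  read from `x_a` along links of the closed half `{0 ≤ x_i + x_j ≤ M_u (mod 2M_u)}`, the matrix
  `(∫ conj tr ρ(hol_{ψ x_a}(w_a^{anti})) · tr ρ(hol_{x_b}(w_b)) dμ_β)_{a,b}` is positive semidefinite.

Everything is `[folklore]` (bookkeeping over the tree's own theorems; no new positivity mechanism).

References: J. Fröhlich, R. Israel, E. H. Lieb, B. Simon, J. Stat. Phys. 22 (1980) 297, §3;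
M. Biskup, in LNM 1970 (2009) §5.4; V. Kazakov, Z. Zheng, arXiv:2203.11360 §3.3 (reduction of the
loop variables by the symmetry group).
-/

noncomputable section

open MeasureTheory
open scoped ComplexOrder ComplexConjugate

namespace Summit.QuantumFields.GaugeBoot

namespace TiltedRP

variable {d N : ℕ} {G : Type*} [Group G]

/-! ### The anti-diagonal mirror of the tilted box on words -/

section Box

variable {i j : Fin d} {Mu Mv L : ℕ}

/-- **The anti-diagonal mirror is an axis swap of the reversed presentation** `(A, e')`,
`e' = revAxis tiltedUnit j`, on EVERY tilted box (no size condition). [folklore] -/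
theorem isAxisSwap_antiDiag (hij : i ≠ j) :
    IsAxisSwap (revAxis (tiltedUnit d i j Mu Mv L) j) i j (tiltedAntiMirror d i j Mu Mv L hij) := by
  have hsi : antiHom d i j (Pi.single i (1 : ℤ)) = -Pi.single j (1 : ℤ) := by
    funext m; rw [antiHom_apply hij, Pi.neg_apply]
    by_cases hmi : m = i
    · subst hmi
      rw [if_pos rfl, Pi.single_eq_of_ne hij.symm, Pi.single_eq_of_ne hij, neg_zero]
    · by_cases hmj : m = j
      · subst hmj
        rw [if_neg hmi, if_pos rfl, Pi.single_eq_same, Pi.single_eq_same]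
      · rw [if_neg hmi, if_neg hmj, Pi.single_eq_of_ne hmi, Pi.single_eq_of_ne hmj, neg_zero]
  have hsj : antiHom d i j (Pi.single j (1 : ℤ)) = -Pi.single i (1 : ℤ) := by
    funext m; rw [antiHom_apply hij, Pi.neg_apply]
    by_cases hmi : m = i
    · subst hmi
      rw [if_pos rfl, Pi.single_eq_same, Pi.single_eq_same]
    · by_cases hmj : m = j
      · subst hmj
        rw [if_neg hmi, if_pos rfl, Pi.single_eq_of_ne hij, Pi.single_eq_of_ne hij.symm, neg_zero]
      · rw [if_neg hmi, if_neg hmj, Pi.single_eq_of_ne hmj, Pi.single_eq_of_ne hmi, neg_zero]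
  have hso : ∀ k, k ≠ i → k ≠ j → antiHom d i j (Pi.single k (1 : ℤ)) = Pi.single k (1 : ℤ) := by
    intro k hki hkj; funext m; rw [antiHom_apply hij]
    by_cases hmi : m = i
    · subst hmi
      rw [if_pos rfl, Pi.single_eq_of_ne (Ne.symm hkj), Pi.single_eq_of_ne (Ne.symm hki), neg_zero]
    · by_cases hmj : m = j
      · subst hmj
        rw [if_neg hmi, if_pos rfl, Pi.single_eq_of_ne (Ne.symm hki), Pi.single_eq_of_ne (Ne.symm hkj),
          neg_zero]
      · rw [if_neg hmi, if_neg hmj]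
  have hmk : ∀ y : Fin d → ℤ, ((y : Fin d → ℤ) : TiltedSite d i j Mu Mv L) =
      QuotientAddGroup.mk' (tiltedLattice d i j Mu Mv L) y := fun y => rfl
  refine { map_e := fun k => ?_, invol := fun q => ?_ }
  · by_cases hki : k = i
    · subst hki
      rw [revAxis_of_ne _ hij, Equiv.swap_apply_left, revAxis_self, tiltedUnit, tiltedUnit,
        tiltedAntiMirror_mk, hsi, hmk, hmk, map_neg]
    · by_cases hkj : k = j
      · subst hkj
        rw [revAxis_self, Equiv.swap_apply_right, revAxis_of_ne _ (Ne.symm hki), map_neg, tiltedUnit,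
          tiltedUnit, tiltedAntiMirror_mk, hsj, hmk, hmk, map_neg, neg_neg]
      · rw [revAxis_of_ne _ hkj, Equiv.swap_apply_of_ne_of_ne hki hkj, revAxis_of_ne _ hkj, tiltedUnit,
          tiltedAntiMirror_mk, hso k hki hkj]
  · induction q using QuotientAddGroup.induction_on with
    | H x => rw [tiltedAntiMirror_mk, tiltedAntiMirror_mk, antiHom_antiHom hij]

/-- **Word holonomies under the anti-diagonal reflection of the tilted box**:
`hol_x(w)(Θ U) = hol_{ψx}(w^{anti})(U)` with `Θ = configAntiSwap`, `ψ = tiltedAntiMirror` and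
`anti = Step.antiSwap i j` letterwise — every box `Γ(M_u, M_v, L)`. [folklore] -/
theorem wordHolonomy_configAntiSwap (hij : i ≠ j) (U : Config (TiltedSite d i j Mu Mv L) d G)
    (x : TiltedSite d i j Mu Mv L) (w : Word d) :
    wordHolonomy (tiltedUnit d i j Mu Mv L) (configAntiSwap hij U) x w =
      wordHolonomy (tiltedUnit d i j Mu Mv L) U (tiltedAntiMirror d i j Mu Mv L hij x)
        (w.map (Step.antiSwap i j)) := by
  rw [configAntiSwap, wordHolonomy_revConfig', (isAxisSwap_antiDiag hij).wordHolonomy_configSwap,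
    wordHolonomy_revConfig, List.map_map, List.map_map]
  congr 1
  exact List.map_congr_left fun s _ => Step.flipAt_permute_flipAt hij s

/-- The anti-diagonal mirror carries the endpoint of a step to the endpoint of the relabelled step.
[folklore] -/
theorem map_move_antiSwap (hij : i ≠ j) (x : TiltedSite d i j Mu Mv L) (s : Step d) :
    tiltedAntiMirror d i j Mu Mv L hij (s.move (tiltedUnit d i j Mu Mv L) x) =
      (s.antiSwap i j).move (tiltedUnit d i j Mu Mv L) (tiltedAntiMirror d i j Mu Mv L hij x) := by
  have hA := isAxisSwap_antiDiag (Mu := Mu) (Mv := Mv) (L := L) hij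
  have h1 : s.move (tiltedUnit d i j Mu Mv L) x =
      (s.flipAt j).move (revAxis (tiltedUnit d i j Mu Mv L) j) x := by
    rw [move_revAxis, Step.flipAt_flipAt]
  rw [h1, hA.map_move, move_revAxis, Step.flipAt_permute_flipAt hij]

/-- Endpoints under the anti-diagonal mirror: `ψ(endpoint_x w) = endpoint_{ψx}(w^{anti})`; in
particular closed words go to closed words. [folklore] -/
theorem Word.endpoint_antiSwap (hij : i ≠ j) (w : Word d) : ∀ x : TiltedSite d i j Mu Mv L,
    tiltedAntiMirror d i j Mu Mv L hij (Word.endpoint (tiltedUnit d i j Mu Mv L) x w) =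
      Word.endpoint (tiltedUnit d i j Mu Mv L) (tiltedAntiMirror d i j Mu Mv L hij x)
        (w.map (Step.antiSwap i j)) := by
  induction w with
  | nil => intro x; rfl
  | cons s w ih =>
    intro x
    rw [List.map_cons, Word.endpoint_cons, Word.endpoint_cons, ih, map_move_antiSwap hij]

variable [NeZero Mu] [NeZero Mv] [NeZero L] [TopologicalSpace G] [IsTopologicalGroup G] [CompactSpace G]
  [MeasurableSpace G] [BorelSpace G] [SecondCountableTopology G] (ρ : G →* Matrix (Fin N) (Fin N) ℂ)

/-- **The Wilson measure of EVERY tilted box is invariant under the anti-diagonal reflection**: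
`∫ F(Θ U) dμ_β = ∫ F dμ_β` for measurable real `F` (every real `β`; no size condition). [folklore] -/
theorem tiltedBox_integral_comp_configAntiSwap (hij : i ≠ j) (hρ : Continuous ρ) (β : ℝ)
    {F : Config (TiltedSite d i j Mu Mv L) d G → ℝ} (hFm : Measurable F) :
    ∫ U, F (configAntiSwap hij U) ∂(gibbs ρ (tiltedUnit d i j Mu Mv L) β) =
      ∫ U, F U ∂(gibbs ρ (tiltedUnit d i j Mu Mv L) β) := by
  set e := tiltedUnit d i j Mu Mv L with he
  set ψ := tiltedAntiMirror d i j Mu Mv L hij with hψ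
  have h1 := integral_comp_revConfig_gibbs ρ hρ e j β
    (fun V => F (revConfig (revAxis e j) j (configSwap i j ψ V)))
  have h2 := (isAxisSwap_antiDiag (Mu := Mu) (Mv := Mv) (L := L) hij).integral_comp_configSwap_gibbs ρ hρ β
    (F := fun V => F (revConfig (revAxis e j) j V)) (hFm.comp (measurable_revConfig _ _))
  have h3 := integral_comp_revConfig_gibbs ρ hρ (revAxis e j) j β F
  rw [revAxis_revAxis] at h3
  simp only [configAntiSwap, ← he, ← hψ] at h1 h2 ⊢
  rw [h1, h2, h3]

/-- The same for complex observables. [folklore] -/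
theorem tiltedBox_integral_comp_configAntiSwap_complex (hij : i ≠ j) (hρ : Continuous ρ) (β : ℝ)
    {F : Config (TiltedSite d i j Mu Mv L) d G → ℂ} (hFm : Measurable F) :
    ∫ U, F (configAntiSwap hij U) ∂(gibbs ρ (tiltedUnit d i j Mu Mv L) β) =
      ∫ U, F U ∂(gibbs ρ (tiltedUnit d i j Mu Mv L) β) := by
  set e := tiltedUnit d i j Mu Mv L with he
  set ψ := tiltedAntiMirror d i j Mu Mv L hij with hψ
  have h1 := integral_comp_revConfig_gibbs_complex ρ hρ e j β
    (fun V => F (revConfig (revAxis e j) j (configSwap i j ψ V)))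
  have h2 := (isAxisSwap_antiDiag (Mu := Mu) (Mv := Mv) (L := L) hij).integral_comp_configSwap_gibbs_complex
    ρ hρ β (F := fun V => F (revConfig (revAxis e j) j V)) (hFm.comp (measurable_revConfig _ _))
  have h3 := integral_comp_revConfig_gibbs_complex ρ hρ (revAxis e j) j β F
  rw [revAxis_revAxis] at h3
  simp only [configAntiSwap, ← he, ← hψ] at h1 h2 ⊢
  rw [h1, h2, h3]

/-- **Loop expectations are invariant under the anti-diagonal mirror**:
`E[tr ρ(hol_{ψx}(w^{anti}))] = E[tr ρ(hol_x(w))]` on every tilted box (every real `β`) — the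
identification by which a certificate quotients its variable set. [folklore] -/
theorem tiltedBox_integral_trace_wordHolonomy_antiSwap (hij : i ≠ j) (hρ : Continuous ρ) (β : ℝ)
    (x : TiltedSite d i j Mu Mv L) (w : Word d) :
    ∫ U, (ρ (wordHolonomy (tiltedUnit d i j Mu Mv L) U (tiltedAntiMirror d i j Mu Mv L hij x)
        (w.map (Step.antiSwap i j)))).trace ∂(gibbs ρ (tiltedUnit d i j Mu Mv L) β) =
      ∫ U, (ρ (wordHolonomy (tiltedUnit d i j Mu Mv L) U x w)).trace
        ∂(gibbs ρ (tiltedUnit d i j Mu Mv L) β) := by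
  have h := tiltedBox_integral_comp_configAntiSwap_complex (Mu := Mu) (Mv := Mv) (L := L) ρ hij hρ β
    (F := fun U => (ρ (wordHolonomy (tiltedUnit d i j Mu Mv L) U x w)).trace)
    (measurable_trace_wordHolonomy ρ hρ _ x w)
  simp only [wordHolonomy_configAntiSwap] at h
  exact h

/-- **Pair expectations are invariant under the anti-diagonal mirror.** [folklore] -/
theorem tiltedBox_integral_trace_mul_trace_wordHolonomy_antiSwap (hij : i ≠ j) (hρ : Continuous ρ)
    (β : ℝ) (x : TiltedSite d i j Mu Mv L) (u v : Word d) :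
    ∫ U, (ρ (wordHolonomy (tiltedUnit d i j Mu Mv L) U (tiltedAntiMirror d i j Mu Mv L hij x)
          (u.map (Step.antiSwap i j)))).trace *
        (ρ (wordHolonomy (tiltedUnit d i j Mu Mv L) U (tiltedAntiMirror d i j Mu Mv L hij x)
          (v.map (Step.antiSwap i j)))).trace ∂(gibbs ρ (tiltedUnit d i j Mu Mv L) β) =
      ∫ U, (ρ (wordHolonomy (tiltedUnit d i j Mu Mv L) U x u)).trace *
        (ρ (wordHolonomy (tiltedUnit d i j Mu Mv L) U x v)).trace
        ∂(gibbs ρ (tiltedUnit d i j Mu Mv L) β) := by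
  have h := tiltedBox_integral_comp_configAntiSwap_complex (Mu := Mu) (Mv := Mv) (L := L) ρ hij hρ β
    (F := fun U => (ρ (wordHolonomy (tiltedUnit d i j Mu Mv L) U x u)).trace *
      (ρ (wordHolonomy (tiltedUnit d i j Mu Mv L) U x v)).trace)
    ((measurable_trace_wordHolonomy ρ hρ _ x u).mul (measurable_trace_wordHolonomy ρ hρ _ x v))
  simp only [wordHolonomy_configAntiSwap] at h
  exact h

/-- **The anti-diagonal RP blocks of EVERY tilted box are positive semidefinite**: for `β ≥ 0`,
`M_u ≥ 2` (any `M_v, L`), bounded measurable observables `F_1, …, F_n` of the closed half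
`{0 ≤ x_i + x_j ≤ M_u (mod 2M_u)}` and `c ∈ ℂ^n`,
`0 ≤ ∑_{a,b} conj c_a · c_b · ∫ conj(F_a(Θ U)) F_b(U) dμ_β`, `Θ = configAntiSwap`. [folklore] -/
theorem tiltedBox_rAntiDiagBlock_nonneg_general (hij : i ≠ j) (hMu : 2 ≤ Mu) (hρ : Continuous ρ)
    {β : ℝ} (hβ : 0 ≤ β) {n : ℕ} (F : Fin n → Config (TiltedSite d i j Mu Mv L) d G → ℂ)
    (hFm : ∀ a, Measurable (F a)) (hFb : ∀ a, ∃ C : ℝ, ∀ U, ‖F a U‖ ≤ C)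
    (hFo : ∀ a, IsHalfObservable (tiltedUnit d i j Mu Mv L) Mu (tiltedAntiHeight d i j Mu Mv L) (F a))
    (c : Fin n → ℂ) :
    0 ≤ ∑ a, ∑ b, conj (c a) * c b *
      ∫ U, conj (F a (configAntiSwap hij U)) * F b U ∂(gibbs ρ (tiltedUnit d i j Mu Mv L) β) := by
  set e := tiltedUnit d i j Mu Mv L with he
  set ψ := tiltedAntiMirror d i j Mu Mv L hij with hψ
  have hF := isTiltedFrame_antiDiag Mu Mv L hij hMu
  have key := hF.sum_mul_conj_integral_nonneg ρ hρ hβ (fun a V => F a (revConfig (revAxis e j) j V))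
    (fun a => (hFm a).comp (measurable_revConfig _ _))
    (fun a => by obtain ⟨C, hC⟩ := hFb a; exact ⟨C, fun V => hC _⟩)
    (fun a => isHalfObservable_comp_revConfig e j _ (hFo a)) c
  have h3 : ∀ a b, ∫ U, conj (F a (configAntiSwap hij U)) * F b U ∂(gibbs ρ e β) =
      ∫ V, conj (F a (revConfig (revAxis e j) j (configSwap i j ψ V))) *
        F b (revConfig (revAxis e j) j V) ∂(gibbs ρ (revAxis e j) β) := by
    intro a b
    rw [← integral_comp_revConfig_gibbs_complex ρ hρ e j β
      (fun V => conj (F a (revConfig (revAxis e j) j (configSwap i j ψ V))) *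
        F b (revConfig (revAxis e j) j V))]
    refine integral_congr_ae (ae_of_all _ fun U => ?_)
    simp only [configAntiSwap, revConfig_revConfig, he, hψ]
  simp_rw [h3]
  exact key

/-- **Anti-diagonal Wilson-loop blocks** (the row-block form of tribunal A31): for `β ≥ 0`, `M_u ≥ 2`
(any `M_v, L`), words `w_1, …, w_n` read from base points `x_1, …, x_n` along links of the closed half
`{0 ≤ x_i + x_j ≤ M_u (mod 2M_u)}` only, and `c ∈ ℂ^n`:
`0 ≤ ∑_{a,b} conj c_a · c_b · ∫ conj(tr ρ(hol_{ψ x_a}(w_a^{anti}))) · tr ρ(hol_{x_b}(w_b)) dμ_β`.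
[folklore] -/
theorem tiltedBox_rAntiDiagWilsonBlock_nonneg (hij : i ≠ j) (hMu : 2 ≤ Mu) (hρ : Continuous ρ)
    {β : ℝ} (hβ : 0 ≤ β) {n : ℕ} (x : Fin n → TiltedSite d i j Mu Mv L) (w : Fin n → Word d)
    (hw : ∀ a k (hk : k < (w a).length), IsHalfLink (tiltedUnit d i j Mu Mv L) Mu
      (tiltedAntiHeight d i j Mu Mv L)
      (((w a).get ⟨k, hk⟩).link (tiltedUnit d i j Mu Mv L) (Word.siteAt (tiltedUnit d i j Mu Mv L) (x a) (w a) k)))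
    (c : Fin n → ℂ) :
    0 ≤ ∑ a, ∑ b, conj (c a) * c b *
      ∫ U, conj ((ρ (wordHolonomy (tiltedUnit d i j Mu Mv L) U (tiltedAntiMirror d i j Mu Mv L hij (x a))
          ((w a).map (Step.antiSwap i j)))).trace) *
        (ρ (wordHolonomy (tiltedUnit d i j Mu Mv L) U (x b) (w b))).trace
        ∂(gibbs ρ (tiltedUnit d i j Mu Mv L) β) := by
  have hb : ∀ a, ∃ C : ℝ, ∀ U : Config (TiltedSite d i j Mu Mv L) d G,
      ‖(ρ (wordHolonomy (tiltedUnit d i j Mu Mv L) U (x a) (w a))).trace‖ ≤ C := fun a => by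
    obtain ⟨C, hC⟩ := isBounded_iff_forall_norm_le.1
      (isCompact_range ((hρ.comp (continuous_wordHolonomy _ (x a) (w a))).matrix_trace)).isBounded
    exact ⟨C, fun U => hC _ ⟨U, rfl⟩⟩
  have h := tiltedBox_rAntiDiagBlock_nonneg_general (Mu := Mu) (Mv := Mv) (L := L) ρ hij hMu hρ hβ
    (fun a U => (ρ (wordHolonomy (tiltedUnit d i j Mu Mv L) U (x a) (w a))).trace)
    (fun a => measurable_trace_wordHolonomy ρ hρ _ (x a) (w a)) hb
    (fun a => isHalfObservable_wordFn _ _ (x a) (w a) (fun g => (ρ g).trace) (hw a)) c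
  simp only [wordHolonomy_configAntiSwap] at h
  exact h

end Box

end TiltedRP

end Summit.QuantumFields.GaugeBoot

end
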